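import Summits.ABC.IUTFork.Cor312UnitCosetCoarseCells
import Summits.ABC.IUTFork.Repair.EvalHonestCeilingL01
import Summits.ABC.IUTFork.Repair.CandJoshi1Barrier
import Summits.ABC.IUTFork.Repair.EvalScalProfile
import HarnessLib

/-!
# IUT REPAIR — cross-checker: the §A «single-image» rows at the COARSE-FRAME COSET bed K (abc-iut-w4-d101 gen 5) — the honest CONTROL column (abc-iut-rp-cx gen 2)

Seat abc-iut-rp-cx (gen 2), rung LADDER-ABC:A2.RP; PROOF-ONLY (no `def`). abc-iut-w4-d101's bed K = `(kFull p, kSetting p, cosetRegion p,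
idealDatum p)` (`Cor312UnitCosetCoarseThm311` p439797, `Cor312UnitCosetCoarse` p441039, `Cor312UnitCosetCoarseCells` p441461) is the first
NON-(Ind)-trivial bed on which EVERY honest clause of the repair protocol holds — typed Thm. 3.11 with (ii)(b), BridgeHyps, three pins, Step (x)
(admissibility transport AND `LogvolInvariant`), exact `j²`, label-free negative q-volume, `|log(q)| > 0` — together with the HULL class
(Licence, GapH3, the Statement WITH EQUALITY) and `¬S` for every q-pinned q-datum (w4-d101's cells, cited BY NAME, not re-proved).
w4-d101 asked the cross-checker for «EVAL-LOG column K». This file types the §A column there: by the gen-0 ceilings every §A row MUST be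
FALSE at K, Kummer-image rows AND possible-image rows alike — K is the CONTROL bed for the §A split recorded at SCAL₀
(`Repair.EvalScalProfile` p440718) and VAL (`Repair.EvalValProfile`, staged): there the possible-image rows turned TRUE exactly because
Step (x) `LogvolInvariant` was re-typed away (door (b)) resp. failed (non-isometric (Ind2)); at K it holds (`kLine_logvolInvariant`).

FINDINGS (kernel, this file; ceilings fed with w4-d101's honesty theorems BY NAME):
* §1 K's data in ceiling shape: `k_thetaRegion_logvol` (EVERY Kummer image, every `m`), `k_thetaRegionsAdm`, `k_thetaAtFinite`, `k_hAdm` /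
  `k_logvolInvariant` / `k_theta3_adm` (Step (x) and admissibility at the setting's own line `n`).
* §2 the column, ALL ✗ as predicted: X04a ✗ (`x04_false_k`; = w4-d101's `kSetting_qRegion_not_subset_thetaRegion3`), C01-VT ✗, C01-GVT ✗,
  C01-QFC ✗, I17 ✗ (I16 ✓, insufficient as everywhere), **L01 ✗ for every `ρ`, `qK`** (`l01_false_k`, cx `EvalHonestCeilingL01.l01_false_of_honestData`),
  **M32b ✗ for every `ρ`, `qK`** (`m32b_false_k`) and **J02 ✗** (`j02_false_k`, rp-j1's `CandJoshi1Barrier.not_joshiVolumeDominance_of_honestAt`) —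
  M32b being the `=`-strengthening of J02's `≤` (`h'_imp_joshiVolumeDominance`).
* §3 PACKAGE `coarse_column_sectionA` (with w4-d101's census BY NAME) and the CONTRAST `possibleImage_rows_split`: L01 and M32b are FALSE
  at K and TRUE at SCAL₀ (p440718) — same `l⋆ = 2`, same prime, both beds `j²`-exact with label-free negative q-volume and the three pins;
  the one protocol clause separating them is Step (x) `LogvolInvariant` (✓ at K, re-typed away at SCAL₀).

READING for the census (neutral): K confirms the corrected §A sentence of HOME/plan/repair/cx/EVAL-SUMMARY.md v1.1 (c) on an honest,
orbit-moving, hull-attaining bed: Kummer-image rows die on exact `j²` alone; possible-image rows die on exact `j²` + Step (x) volume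
invariance, and on nothing less. No side taken on [IUTchIII] Cor. 3.12, on abc, or on any author; candidates are hypotheses, never
asserted; K is a model of the typed interface, not of initial Θ-data (w4-d101's honest scope: one place, `l⋆ = 2`, frame inflation declared);
typed ≠ proved.
-/

noncomputable section

namespace Summit.ABC.IUTFork.Repair.EvalCoarseProfile

open Set Cor312 Cor312.Checks Cor312.IdentifiedNonVacuity Cor312Vol Cor312Vol.NaiveWitness Cor312Vol.PinnedWitness
  Cor312Vol.PinnedHonest Cor312Vol.UnitWitness Cor312Vol.UnitCoset Cor312Vol.UnitCosetCoarse Literature.IUT.LogThetaLattice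
open Thm311 hiding toyIndex

variable (p : ℕ) [hp : Fact p.Prime]

/-! ## 1. K's honest data in ceiling shape -/

/-- **Every Kummer image is honestly scaled at K** (all `(n,m)`-images coincide with the (Ind3)-union; w4-d101's `kSetting_scaled`). [folklore] -/
theorem k_thetaRegion_logvol (m : ℤ) (i : Fin toyIndex.lstar) (vQ : toyIndex.VQ) :
    ((kFull p).D (kSetting p).n).logvol _ vQ ((kSetting p).thetaRegion m (Setting.labelSucc i) vQ) =
      (((i : ℕ) + 1 : ℕ) : ℝ) ^ 2 * (kSetting p).qLocal (Setting.labelSucc i) vQ := by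
  rw [show (kSetting p).thetaRegion m (Setting.labelSucc i) vQ = (kSetting p).thetaRegion 0 (Setting.labelSucc i) vQ from rfl,
    ← kSetting_thetaRegion3]
  exact kSetting_scaled p i vQ

/-- Every Kummer image is admissible at K. [folklore] -/
theorem k_thetaRegionsAdm : ThetaRegionsAdm (kSetting p) := fun m i vQ => by
  rw [show (kSetting p).thetaRegion m (Setting.labelSucc i) vQ = (kSetting p).thetaRegion 0 (Setting.labelSucc i) vQ from rfl,
    ← kSetting_thetaRegion3]
  exact kSetting_thetaRegion3_adm p _ vQ

/-- The Θ-side column volumes are finitely supported at K (one place). [folklore] -/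
theorem k_thetaAtFinite (m : ℤ) : CandInternal41.ThetaAtFinite (kFull p).toLatticeSituation (kSetting p) m := fun _ => Set.toFinite _

/-- Step (x), admissibility half, at the setting's line (w4-d101's `kLine_hAdm`). [folklore] -/
theorem k_hAdm : ∀ Φ ∈ (unitShells p).Ind1Family ∪ (unitShells p).Ind2Family,
    ∀ (j : toyIndex.Label) (vQ : toyIndex.VQ) (B : Set ((unitShells p).Packet j vQ)),
      ((kFull p).D (kSetting p).n).Adm j vQ B ↔ ((kFull p).D (kSetting p).n).Adm j vQ (Φ j vQ '' B) :=
  kLine_hAdm p 0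

/-- Step (x), volume half, at the setting's line (w4-d101's `kLine_logvolInvariant`). [folklore] -/
theorem k_logvolInvariant : ((kFull p).D (kSetting p).n).LogvolInvariant := kLine_logvolInvariant p 0

/-- Admissibility of the (Ind3)-enlarged Θ-regions at the setting's line (w4-d101's `kSetting_thetaRegion3_adm`). [folklore] -/
theorem k_theta3_adm (j : toyIndex.Label) (vQ : toyIndex.VQ) :
    ((kFull p).D (kSetting p).n).Adm j vQ ((kSetting p).thetaRegion3 j vQ) := kSetting_thetaRegion3_adm p j vQ

/-! ## 2. The K column of §A — every row FALSE -/

/-- **RP-X04a ✗ at K** (gen-0 ceiling; directly w4-d101's `kSetting_qRegion_not_subset_thetaRegion3`: `0 ∈ q𝒪`, `0 ∉ ±q^{j²}(1+p𝒪)`). [folklore] -/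
theorem x04_false_k : ¬ CandExplicit4.H (kFull p).toLatticeSituation (kSetting p) :=
  EvalHonestCeiling.x04_false_of_bridgeHyps (kFull p).toLatticeSituation (kSetting p) (kSetting_bridgeHyps p) ⟨1, by decide⟩ le_rfl ()
    (kSetting_scaled p _ ()) (kSetting_qLocal_neg p _ ())

/-- **RP-C01-VT ✗ at K.** [folklore] -/
theorem volumeTransport_false_k : ¬ VolumeTransport (kSetting p) :=
  EvalHonestCeiling.volumeTransport_false_of_bridgeHyps (kFull p).toLatticeSituation (kSetting p) (kSetting_bridgeHyps p)
    (k_thetaRegionsAdm p) ⟨1, by decide⟩ le_rfl () (kSetting_scaled p _ ()) (kSetting_qLocal_neg p _ ())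

/-- **RP-C01-GVT ✗ at K.** [folklore] -/
theorem globalVolumeTransport_false_k : ¬ GlobalVolumeTransport (kSetting p) :=
  EvalHonestCeiling.globalVolumeTransport_false_of_bridgeHyps (kFull p).toLatticeSituation (kSetting p) (kSetting_bridgeHyps p)
    (k_thetaRegionsAdm p) (kSetting_scaled p) (kSetting_indep p) (kSetting_absLogQPos p)

/-- **RP-C01-QFC ✗ at K** ((ii)(a) `KummerA` from w4-d101's `kFull_statement`). [folklore] -/
theorem qFrobComparison_false_k : ¬ QFrobComparison (S' := (kFull p).toLatticeSituation) (kSetting p) :=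
  EvalHonestCeiling.no_satPlus_qFrobComparison (kFull p) (kSetting p) () (kFull_statement p) (kSetting_bridgeHyps p)
    (k_thetaRegionsAdm p) (kSetting_scaled p) (kSetting_qLocal_neg p)

/-- **RP-I16 ✓ at K** (`c = 1/PN(j²)`; abc-iut-rp-d4's ∀-form BY NAME) — insufficient, as everywhere (`¬S` at K). [folklore] -/
theorem hDegreeOrbit_k : CandInternal41.HDegreeOrbit (kFull p).toLatticeSituation (kSetting p) :=
  CandInternal41Profile.hDegreeOrbit_of_scaled _ _ (k_thetaAtFinite p) (k_thetaRegion_logvol p) (kSetting_indep p)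

/-- **RP-I17 = I4d′ ✗ at K.** [folklore] -/
theorem not_hDegreeOrbitGe_k : ¬ CandInternal41.HDegreeOrbitGe (kFull p).toLatticeSituation (kSetting p) :=
  CandInternal41Profile.not_hDegreeOrbitGe_of_scaled _ _ (k_thetaRegion_logvol p) (kSetting_indep p) (kSetting_absLogQPos p)

variable (ρ : (∀ v : toyIndex.V, v ∈ toyIndex.Vbad → Set ((unitShells p).StarPacket v)) →
    ∀ (j : toyIndex.Label) (vQ : toyIndex.VQ), Set ((unitShells p).Packet j vQ))
  (qK : ∀ v : toyIndex.V, v ∈ toyIndex.Vbad → Set ((unitShells p).StarPacket v))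

/-- **RP-L01 ✗ at K, for EVERY `ρ`, `qK`** (cx `l01_false_of_honestData`: BridgeHyps, Step (x), exact `j²`, label-free q, `|log(q)| > 0`).
Contrast: ✓ at SCAL₀ (`EvalScalProfile.l01_holds_wSetting`) and at VAL. [folklore] -/
theorem l01_false_k : ¬ CandLana1.H (kFull p).toLatticeSituation (kSetting p) ρ qK :=
  EvalHonestCeilingL01.l01_false_of_honestData (kFull p).toLatticeSituation (kSetting p) ρ qK (kSetting_bridgeHyps p) (k_hAdm p) (k_logvolInvariant p)
    (kSetting_scaled p) (kSetting_indep p) (kSetting_absLogQPos p)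

/-- RP-M32b (`=` in every packet) implies RP-J02 (`≤` in every packet) on any setting. [folklore] -/
theorem h'_imp_joshiVolumeDominance {T : ThetaIndex} (S : LatticeSituation T) (P : Cor312.Setting S.toSituation)
    (ρ' : (∀ v : T.V, v ∈ T.Vbad → Set (S.L.StarPacket v)) → ∀ (j : T.Label) (vQ : T.VQ), Set (S.L.Packet j vQ))
    (qK' : ∀ v : T.V, v ∈ T.Vbad → Set (S.L.StarPacket v)) (h : CandMochizuki32.H' S P ρ' qK') :
    CandJoshi1.JoshiVolumeDominance P := fun i vQ => by
  obtain ⟨U, hU, he⟩ := h i vQ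
  exact ⟨U, hU, he.le⟩

/-- **RP-J02 ✗ at K** (abc-iut-rp-j1's `not_joshiVolumeDominance_of_honestAt` at label `2`). Contrast: ✓ at VAL (rp-j2's
`val_joshiVolumeDominance`). [folklore] -/
theorem j02_false_k : ¬ CandJoshi1.JoshiVolumeDominance (kSetting p) :=
  CandJoshi1Barrier.not_joshiVolumeDominance_of_honestAt (S₀ := (kFull p).toLatticeSituation.toSituation) (kSetting p) (k_hAdm p) (k_logvolInvariant p)
    ⟨1, by decide⟩ le_rfl () (k_theta3_adm p _ ()) (kSetting_scaled p _ ()) (kSetting_qLocal_neg p _ ())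

/-- **RP-M32b ✗ at K, for EVERY `ρ`, `qK`.** Contrast: ✓ at SCAL₀ (`EvalScalProfile.m32_holds_wSetting`) and at VAL. [folklore] -/
theorem m32b_false_k : ¬ CandMochizuki32.H' (kFull p).toLatticeSituation (kSetting p) ρ qK := fun h =>
  j02_false_k p (h'_imp_joshiVolumeDominance _ _ ρ qK h)

/-! ## 3. Package and the contrast with SCAL₀ -/

/-- **THE K COLUMN OF §A, with w4-d101's census BY NAME.** Census: typed Thm. 3.11 ✓, (ii)(b) ✓, BridgeHyps ✓, three pins ✓, `|log(q)| > 0` ✓,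
Step (x) ✓ (both halves), Licence ✓, Statement ✓ with equality, `¬S` for every q-pinned q-datum. Column: X04a, C01-VT, C01-GVT, C01-QFC, I17,
L01, M32b, J02 ALL FALSE (I16 TRUE). [folklore] -/
theorem coarse_column_sectionA :
    ((kFull p).Statement ∧ ((kFull p).col (kSetting p).n).KummerB ((kFull p).D (kSetting p).n) ∧ BridgeHyps (kSetting p) ∧
      PinnedRegions3 (kFull p).toLatticeSituation (kSetting p) (cosetRegion p) (idealDatum p) ∧ (kSetting p).AbsLogQPos ∧
      ((kFull p).D (kSetting p).n).LogvolInvariant ∧ Thm311ToCor312.Licence (kSetting p) ∧ (kSetting p).Statement ∧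
      (kSetting p).negLogTheta = (((kSetting p).negLogQ : ℝ) : WithTop ℝ) ∧
      (∀ qK', QPinned (kFull p).toLatticeSituation (kSetting p) (cosetRegion p) qK' →
        ¬ PilotKummerIndRelated (kFull p).toLatticeSituation (kSetting p) (cosetRegion p) qK')) ∧
    (¬ CandExplicit4.H (kFull p).toLatticeSituation (kSetting p) ∧ ¬ VolumeTransport (kSetting p) ∧
      ¬ GlobalVolumeTransport (kSetting p) ∧ ¬ QFrobComparison (S' := (kFull p).toLatticeSituation) (kSetting p) ∧
      ¬ CandInternal41.HDegreeOrbitGe (kFull p).toLatticeSituation (kSetting p) ∧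
      ¬ CandLana1.H (kFull p).toLatticeSituation (kSetting p) (cosetRegion p) (idealDatum p) ∧
      ¬ CandMochizuki32.H' (kFull p).toLatticeSituation (kSetting p) (cosetRegion p) (idealDatum p) ∧
      ¬ CandJoshi1.JoshiVolumeDominance (kSetting p)) ∧
    CandInternal41.HDegreeOrbit (kFull p).toLatticeSituation (kSetting p) :=
  ⟨⟨kFull_statement p, kColumn_kummerB p 0, kSetting_bridgeHyps p, kSetting_pinnedRegions3 p, kSetting_absLogQPos p,
      k_logvolInvariant p, kSetting_licence p, kSetting_statement p, kSetting_negLogTheta_eq_negLogQ p,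
      fun qK' hq => kSetting_not_pilotKummerIndRelated_of_qPinned p qK' hq⟩,
    ⟨x04_false_k p, volumeTransport_false_k p, globalVolumeTransport_false_k p, qFrobComparison_false_k p, not_hDegreeOrbitGe_k p,
      l01_false_k p _ _, m32b_false_k p _ _, j02_false_k p⟩,
    hDegreeOrbit_k p⟩

/-- **THE POSSIBLE-IMAGE ROWS SPLIT ON Step (x) VOLUME INVARIANCE** — same prime, same `l⋆ = 2`, both beds `j²`-exact with label-free
negative q-volume and the three pins: at K (Step (x) `LogvolInvariant` ✓) RP-L01 and RP-M32b are FALSE for every `ρ`, `qK`; at the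
door-(b) bed SCAL₀ (`LogvolInvariant` re-typed away; cx `EvalScalProfile` p440718) they are TRUE for every `ρ`, `qK`. [folklore] -/
theorem possibleImage_rows_split :
    (((kFull p).D (kSetting p).n).LogvolInvariant ∧
      (∀ ρ' qK', ¬ CandLana1.H (kFull p).toLatticeSituation (kSetting p) ρ' qK') ∧
      (∀ ρ' qK', ¬ CandMochizuki32.H' (kFull p).toLatticeSituation (kSetting p) ρ' qK')) ∧
    (¬ BridgeHyps (ObstructionSS6Witness.wSetting p) ∧
      (∀ ρ' qK', CandLana1.H (ScalarShellsThm311Zero.sFull₀ p).toLatticeSituation (ObstructionSS6Witness.wSetting p) ρ' qK') ∧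
      (∀ ρ' qK', CandMochizuki32.H' (ScalarShellsThm311Zero.sFull₀ p).toLatticeSituation (ObstructionSS6Witness.wSetting p) ρ' qK')) :=
  ⟨⟨k_logvolInvariant p, fun ρ' qK' => l01_false_k p ρ' qK', fun ρ' qK' => m32b_false_k p ρ' qK'⟩,
    ⟨(ObstructionSS6Witness.wSetting_price p).2.2.2,
      fun ρ' qK' => EvalScalProfile.l01_holds_wSetting p ρ' qK', fun ρ' qK' => (EvalScalProfile.m32_holds_wSetting p ρ' qK').2.1⟩⟩

end Summit.ABC.IUTFork.Repair.EvalCoarseProfile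

end
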